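/-
Copyright: statement-level skeleton of a published paper (lit-balaban cell, Phase-2 proof seat p25, gen 18). No proof
claims beyond what the kernel checks below.
-/
import Literature.MathematicalPhysics.QuantumFieldTheory.BalabanImbrieJaffe1984to88.BIJ88WalkLocalCount312

/-!
# `BalabanImbrieJaffe1984to88.BIJ88WalkVertexCount311` — T. Bałaban, J. Imbrie, A. Jaffe, *Effective action and cluster
properties of the abelian Higgs model*, Commun. Math. Phys. **114** (1988) 257–315 [BalabanImbrieJaffe1988], §5.14
p. 310 [PDF 54], verbatim: *"Recall that C^{(k)}_Λ is the Dirichlet inverse to (5.13.2), and we define C^{(k)}_{Λ,loc}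
by cutting off the kernel when the arguments are separated by O(r(e_k))."*, p. 309 [PDF 53] verbatim: *"using the
fact that V^{(k)}(Y) is a small polynomial in A^{(k)}, φ^{(k)}"* (the interaction is a sum of terms `V^{(k)}(Y)`
localized in regions `Y`) (DOCFIX p25 gen 19, ref-5 D-g64-2: the gen-18 header carried a PARAPHRASE of the locality of
`C_loc` and of the interaction inside quotation marks — *"by construction, C_loc(x,y) … vanish for |x−y| > r(e_k) …
V involves only local couplings"* is NOT a printed sentence; the printed sentences nearest to the two modelling
hypotheses of this file are the ones now quoted, declarations untouched) — **THE NUMBER OF VERTEX LEGS COUPLED TO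
ONE PIECE IS BOUNDED** (p25 gen 18): the
second locality hypothesis of the local count (`BIJ88WalkLocalCount312.run_lsum_le`: at most `N₀` (vertex, leg)
pairs `(m, j)` with `⟨C_p u, (legs m)_j⟩ ≠ 0`) DERIVED from: a non-zero bracket `⟨C_p u, w⟩` puts the cube of `w` in a
set `nb p u` of at most `ν` cubes (the range of `C_loc` around the cube of `u`; the end of the walk for a walk term),
and at most `n₀` vertex legs are located in any one cube (local couplings).  Then `N₀ = ν·n₀`, uniformly in the
number of vertices (the volume).

statement-level skeleton of published theorems with citation tags; proofs where landed; nothing here is a claim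
about the Yang–Mills mass gap

PDF held: `paper:balaban1988-cmp114-bij-abelian-higgs-effective-action` (journal page = PDF page + 256); p. 309–310 =
PDF 53–54 (`p0054.txt` L33–35 and `p0053.txt` L17–18 re-read for the docfix, 2026-08-23).

CITATION HEADER (lean-in-tree rule).  lit-balaban cell (HOME `run/shared/lean/pub/lit-balaban/`), Phase 2, seat p25
gen 18; row **C2.Claim@312** of `HOME/lit-balaban-r16/ROWS-C2-part2.md` (owner r16, referee ref-5; head
`BIJ88Sect5StatementsPart4.Ineq312` untouched — MEMBER of the row).  USED BY NAME, nothing restated: Mathlib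
(`Finset.card_eq_sum_card_fiberwise`, `Finset.card_le_card`); the hypothesis shape `hN` of
`BIJ88WalkLocalCount312.run_lsum_le`.

## What is proved (0 `sorry`, standard axioms, no new `Prop` facts; theorems only)

* **`coupled_vertex_legs_le`**: `Σ_m #{j < |legs m| : ⟨C_p u, (legs m)_j⟩ ≠ 0} ≤ ν·n₀`.
HONEST SCOPE: the range set `nb p u` with `#nb ≤ ν` and the bound `n₀` on vertex legs per cube are HYPOTHESES about
`C_loc`, the walk terms and `V` (modelling hypotheses; print: p. 310 cut-off of `C_loc` at `O(r(e_k))`, p. 309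
`V^{(k)}(Y)` localized), not derived from §5.13; no `Ineq312` binder.  NOT summit progress; NOT
continuum; NOT Clay.  Imports `BIJ88WalkLocalCount312`; modifies nothing.
-/

noncomputable section

namespace Literature.MathematicalPhysics.QuantumFieldTheory.BalabanImbrieJaffe1984to88.BIJ88WalkVertexCount311

open Classical Matrix Finset
open scoped BigOperators

/-- **AT MOST `ν·n₀` VERTEX LEGS ARE COUPLED TO ONE PIECE ACTING ON ONE LEG**: if `⟨C_p u, w⟩ ≠ 0` forces the cube
`lc w` into a set `nb p u` of at most `ν` cubes, and at most `n₀` vertex legs `(m, j)` are located in any cube, then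
`Σ_m #{j < |legs m| : ⟨C_p u, (legs m)_j⟩ ≠ 0} ≤ ν·n₀` — the hypothesis `hN` of `BIJ88WalkLocalCount312.run_lsum_le`
with `N₀ = ν·n₀`, whatever the number of vertices. [cite: BalabanImbrieJaffe1988, §5.14 p.311] -/
theorem coupled_vertex_legs_le {S ι β P : Type} [Fintype S] [Fintype ι] [DecidableEq β] {Cov : P → Matrix S S ℝ}
    {legs : ι → List (S → ℝ)} {lc : (S → ℝ) → β} {nb : P → (S → ℝ) → Finset β} {ν n₀ : ℕ}
    (hnb : ∀ p u w, (Cov p *ᵥ u) ⬝ᵥ w ≠ 0 → lc w ∈ nb p u) (hν : ∀ p u, (nb p u).card ≤ ν)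
    (hn₀ : ∀ x : β, (∑ m, ((range (legs m).length).filter fun j => lc ((legs m).getD j 0) = x).card) ≤ n₀)
    (p : P) (u : S → ℝ) :
    (∑ m, ((range (legs m).length).filter fun j => (Cov p *ᵥ u) ⬝ᵥ (legs m).getD j 0 ≠ 0).card) ≤ ν * n₀ := by
  -- a coupled leg sits in a cube of `nb p u`
  have h1 : ∀ m, ((range (legs m).length).filter fun j => (Cov p *ᵥ u) ⬝ᵥ (legs m).getD j 0 ≠ 0).card
      ≤ ((range (legs m).length).filter fun j => lc ((legs m).getD j 0) ∈ nb p u).card := fun m =>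
    Finset.card_le_card fun j hj => by
      rw [Finset.mem_filter] at hj ⊢
      exact ⟨hj.1, hnb p u _ hj.2⟩
  -- and the legs in the cubes of `nb p u` are counted cube by cube
  have h2 : ∀ m, ((range (legs m).length).filter fun j => lc ((legs m).getD j 0) ∈ nb p u).card
      ≤ ∑ x ∈ nb p u, ((range (legs m).length).filter fun j => lc ((legs m).getD j 0) = x).card := fun m => by
    have hc := Finset.card_eq_sum_card_fiberwise
      (s := (range (legs m).length).filter fun j => lc ((legs m).getD j 0) ∈ nb p u) (t := nb p u)
      (f := fun j => lc ((legs m).getD j 0)) fun j hj => (Finset.mem_filter.1 hj).2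
    rw [hc]
    refine Finset.sum_le_sum fun x _ => Finset.card_le_card fun j hj => ?_
    simp only [Finset.mem_filter] at hj ⊢
    exact ⟨hj.1.1, hj.2⟩
  calc (∑ m, ((range (legs m).length).filter fun j => (Cov p *ᵥ u) ⬝ᵥ (legs m).getD j 0 ≠ 0).card)
      ≤ ∑ m, ∑ x ∈ nb p u, ((range (legs m).length).filter fun j => lc ((legs m).getD j 0) = x).card :=
        Finset.sum_le_sum fun m _ => (h1 m).trans (h2 m)
    _ = ∑ x ∈ nb p u, ∑ m, ((range (legs m).length).filter fun j => lc ((legs m).getD j 0) = x).card :=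
        Finset.sum_comm
    _ ≤ ∑ _x ∈ nb p u, n₀ := Finset.sum_le_sum fun x _ => hn₀ x
    _ ≤ ν * n₀ := by
        rw [Finset.sum_const, smul_eq_mul]
        exact Nat.mul_le_mul_right _ (hν p u)

end Literature.MathematicalPhysics.QuantumFieldTheory.BalabanImbrieJaffe1984to88.BIJ88WalkVertexCount311

end
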